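import Summits.QuantumFields.YangMills.Theorems.FemtoCutoffLadderLocalWallOfRarity

/-!
# Route `FemtoCutoffLadder`, LINE g5-A: ONE wall step `(Q, p₀)` from one-plaquette rarity AT `(Q, p₀)` — and the two extreme wall sets
# `SingleWallStep` (stmt-QuantumFields-26631, `Q = ∅`, the lead's FIRST ATTACK) / `LastWallStep` (26638, `Q = univ ∖ {p₀}`) BY NAME

Seat `leafhand-qf-femtocutoffladder-2` g0 (2026-08-30), `--supports stmt-QuantumFields-26282` (crux `LocalWallStep`; 26631/26638 are its literal
specialisations, ✓`singleWallStep_of_localWallStep` / ✓`lastWallStep_of_localWallStep`, and `SingleWallStep` is the declared first attack of the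
line «comparisons»).  ✓`localWallStep_of_onePlaquetteRarity` (p795124) asks the rarity hypothesis (R) for EVERY wall set; this file localises it:

* §1 ★ `oneWallLowerBounds_of_rarityAt`: on ONE lattice, for ONE `(Q, p₀)`, (R_T)(Q,p₀) ∧ (R_S)(Q,p₀) ⟹ (T) `t Q ≤ e^{A/(β²N)/L} t (Q ∪ {p₀})`
  and (S) `s Q ≤ e^{A/(β²N)/L} s (Q ∪ {p₀})`; ★ `crossComparisons_of_rarityAt`: hence the two cross-multiplied `L`-th-power clauses of the items.
* §2 ★ `singleWallStep_of_onePlaquetteRarityAtEmpty`: `SingleWallStep` BY NAME from (R) at `Q = ∅` only (near-optimal UNWALLED trial states put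
  fraction `≤ c²·value/λ₀` on ONE κ-bad plaquette); ★ `lastWallStep_of_onePlaquetteRarityAtCoatom`: `LastWallStep` BY NAME from (R) at
  `Q = univ ∖ {p₀}`.
Rate `c = (1 − e^{−A/(2β²NL)})/2`, passed as a named parameter with its defining equation.  HONEST FRAMING: conditional bookkeeping; the rarity
statements are the open content (XL, not in print).  R2b1 RECORD rung — not infinite volume, not a mass gap, not Clay; no summit is proved by
this file.  No definitions, no named facts, no `sorry`.  [cite: ReedSimonIV1978, Thm. XIII.1]
-/

set_option autoImplicit false

noncomputable section

open MeasureTheory Filter Topology Real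
open Literature.MathematicalPhysics.QuantumFieldTheory hiding SU2
open Literature.MathematicalPhysics.QuantumLattice

namespace Summit.QuantumFields.YangMills.Theorems.FemtoTransferGap.SFCompression

variable {L : ℕ} [NeZero L]

/-! ## §1 One wall step from rarity at that step -/

/-- ★ **One wall step from one-plaquette rarity at `(Q, p₀)`** (`β > 0`, real `κ`, `A > 0`, `c = (1 − e^{−A/(2β²NL)})/2`): (R_T)(Q,p₀) and
(R_S)(Q,p₀) give `t Q ≤ e^{A/(β²N)/L} · t (Q ∪ {p₀})` and `s Q ≤ e^{A/(β²N)/L} · s (Q ∪ {p₀})`. [cite: ReedSimonIV1978, Thm. XIII.1] -/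
theorem oneWallLowerBounds_of_rarityAt {β : ℝ} (hβ : 0 < β) (κ : ℝ) {A : ℝ} (hA : 0 < A) (Q : Set (Plaquette 3 L)) (p₀ : Plaquette 3 L)
    {c : ℝ} (hc : c = (1 - Real.exp (-(A / β ^ 2 / (Fintype.card (Plaquette 3 L) : ℝ) / L / 2))) / 2)
    (hRT : ∀ f : GaugeConfig 3 L SU2 → ℝ, IsPhys f →
      (∀ U : GaugeConfig 3 L SU2,
        (∃ p ∈ Q, β ^ (κ - 1) < 2 - (su2Rep (plaquetteHolonomy U p.1 p.2.1.1 p.2.1.2)).trace.re) → f U = 0) →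
      0 < l2 f f →
      sSup (rayleighSet su2Rep L β fun ψ => ∀ U : GaugeConfig 3 L SU2,
        (∃ p ∈ Q, β ^ (κ - 1) < 2 - (su2Rep (plaquetteHolonomy U p.1 p.2.1.1 p.2.1.2)).trace.re) → ψ U = 0) * (1 - c) ^ 2 *
        l2 f f ≤ qform su2Rep β f f →
      l2 ({U : GaugeConfig 3 L SU2 | β ^ (κ - 1) < 2 - (su2Rep (plaquetteHolonomy U p₀.1 p₀.2.1.1 p₀.2.1.2)).trace.re}.indicator f)
        ({U : GaugeConfig 3 L SU2 | β ^ (κ - 1) < 2 - (su2Rep (plaquetteHolonomy U p₀.1 p₀.2.1.1 p₀.2.1.2)).trace.re}.indicator f) ≤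
        sSup (rayleighSet su2Rep L β fun ψ => ∀ U : GaugeConfig 3 L SU2,
          (∃ p ∈ Q, β ^ (κ - 1) < 2 - (su2Rep (plaquetteHolonomy U p.1 p.2.1.1 p.2.1.2)).trace.re) → ψ U = 0) * c ^ 2 /
          topValue su2Rep L β * l2 f f)
    (hRS : ∀ f₁ f₂ : GaugeConfig 3 L SU2 → ℝ, IsPhys f₁ → IsPhys f₂ →
      (∀ U : GaugeConfig 3 L SU2,
        (∃ p ∈ Q, β ^ (κ - 1) < 2 - (su2Rep (plaquetteHolonomy U p.1 p.2.1.1 p.2.1.2)).trace.re) → f₁ U = 0) →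
      (∀ U : GaugeConfig 3 L SU2,
        (∃ p ∈ Q, β ^ (κ - 1) < 2 - (su2Rep (plaquetteHolonomy U p.1 p.2.1.1 p.2.1.2)).trace.re) → f₂ U = 0) →
      l2 f₁ f₁ = 1 → l2 f₂ f₂ = 1 → l2 f₁ f₂ = 0 →
      (∀ a b : ℝ, sInf {x : ℝ | ∃ φ : GaugeConfig 3 L SU2 → ℝ, IsPhys φ ∧
        x = sSup (rayleighSet su2Rep L β fun ψ => (∀ U : GaugeConfig 3 L SU2,
          (∃ p ∈ Q, β ^ (κ - 1) < 2 - (su2Rep (plaquetteHolonomy U p.1 p.2.1.1 p.2.1.2)).trace.re) → ψ U = 0) ∧ l2 ψ φ = 0)} *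
          (1 - c) ^ 2 * (a ^ 2 + b ^ 2) ≤ qform su2Rep β (a • f₁ + b • f₂) (a • f₁ + b • f₂)) →
      ∀ a b : ℝ,
        l2 ({U : GaugeConfig 3 L SU2 | β ^ (κ - 1) < 2 - (su2Rep (plaquetteHolonomy U p₀.1 p₀.2.1.1 p₀.2.1.2)).trace.re}.indicator
            (a • f₁ + b • f₂))
          ({U : GaugeConfig 3 L SU2 | β ^ (κ - 1) < 2 - (su2Rep (plaquetteHolonomy U p₀.1 p₀.2.1.1 p₀.2.1.2)).trace.re}.indicator
            (a • f₁ + b • f₂)) ≤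
          sInf {x : ℝ | ∃ φ : GaugeConfig 3 L SU2 → ℝ, IsPhys φ ∧
            x = sSup (rayleighSet su2Rep L β fun ψ => (∀ U : GaugeConfig 3 L SU2,
              (∃ p ∈ Q, β ^ (κ - 1) < 2 - (su2Rep (plaquetteHolonomy U p.1 p.2.1.1 p.2.1.2)).trace.re) → ψ U = 0) ∧ l2 ψ φ = 0)} *
            c ^ 2 / topValue su2Rep L β * (a ^ 2 + b ^ 2)) :
    sSup (rayleighSet su2Rep L β fun ψ => ∀ U : GaugeConfig 3 L SU2,
        (∃ p ∈ Q, β ^ (κ - 1) < 2 - (su2Rep (plaquetteHolonomy U p.1 p.2.1.1 p.2.1.2)).trace.re) → ψ U = 0) ≤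
      Real.exp (A / β ^ 2 / (Fintype.card (Plaquette 3 L) : ℝ) / L) *
        sSup (rayleighSet su2Rep L β fun ψ => ∀ U : GaugeConfig 3 L SU2,
          (∃ p ∈ insert p₀ Q, β ^ (κ - 1) < 2 - (su2Rep (plaquetteHolonomy U p.1 p.2.1.1 p.2.1.2)).trace.re) → ψ U = 0) ∧
    sInf {x : ℝ | ∃ φ : GaugeConfig 3 L SU2 → ℝ, IsPhys φ ∧
        x = sSup (rayleighSet su2Rep L β fun ψ => (∀ U : GaugeConfig 3 L SU2,
          (∃ p ∈ Q, β ^ (κ - 1) < 2 - (su2Rep (plaquetteHolonomy U p.1 p.2.1.1 p.2.1.2)).trace.re) → ψ U = 0) ∧ l2 ψ φ = 0)} ≤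
      Real.exp (A / β ^ 2 / (Fintype.card (Plaquette 3 L) : ℝ) / L) *
        sInf {x : ℝ | ∃ φ : GaugeConfig 3 L SU2 → ℝ, IsPhys φ ∧
          x = sSup (rayleighSet su2Rep L β fun ψ => (∀ U : GaugeConfig 3 L SU2,
            (∃ p ∈ insert p₀ Q, β ^ (κ - 1) < 2 - (su2Rep (plaquetteHolonomy U p.1 p.2.1.1 p.2.1.2)).trace.re) → ψ U = 0) ∧
            l2 ψ φ = 0)} := by
  -- abbreviations
  set tQ : ℝ := sSup (rayleighSet su2Rep L β fun ψ => ∀ U : GaugeConfig 3 L SU2,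
    (∃ p ∈ Q, β ^ (κ - 1) < 2 - (su2Rep (plaquetteHolonomy U p.1 p.2.1.1 p.2.1.2)).trace.re) → ψ U = 0) with htQ
  set sQ : ℝ := sInf {x : ℝ | ∃ φ : GaugeConfig 3 L SU2 → ℝ, IsPhys φ ∧
    x = sSup (rayleighSet su2Rep L β fun ψ => (∀ U : GaugeConfig 3 L SU2,
      (∃ p ∈ Q, β ^ (κ - 1) < 2 - (su2Rep (plaquetteHolonomy U p.1 p.2.1.1 p.2.1.2)).trace.re) → ψ U = 0) ∧ l2 ψ φ = 0)} with hsQ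
  have hNpos : 0 < (Fintype.card (Plaquette 3 L) : ℝ) := by
    have : 0 < Fintype.card (Plaquette 3 L) := Fintype.card_pos_iff.mpr ⟨p₀⟩
    exact_mod_cast this
  have hLpos : 0 < (L : ℝ) := Nat.cast_pos.mpr (Nat.pos_of_ne_zero (NeZero.ne L))
  set a' : ℝ := A / β ^ 2 / (Fintype.card (Plaquette 3 L) : ℝ) / L with ha'
  have ha'pos : 0 < a' := by positivity
  have hca : c = (1 - Real.exp (-(a' / 2))) / 2 := by rw [hc, ha']
  obtain ⟨hc0, hc12, hc2⟩ := rate_facts ha'pos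
  rw [← hca] at hc0 hc12 hc2
  have hl0 : 0 < topValue su2Rep L β := topValue_su2Rep_pos L β
  have hcsq : c ^ 2 ≤ (1 - c) ^ 2 := by nlinarith
  constructor
  · -- (T)
    have hX : 0 < tQ := walledTop_pos L hβ κ Q
    have hXle : tQ ≤ topValue su2Rep L β := sSup_rayleighSet_le_topValue hβ.le _
    set δ : ℝ := tQ - tQ * (1 - c) ^ 2 with hδdef
    set ε : ℝ := tQ * c ^ 2 / topValue su2Rep L β with hεdef
    have hXδ : tQ - δ = tQ * (1 - c) ^ 2 := by rw [hδdef]; ring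
    have hlmε : topValue su2Rep L β * ε = tQ * c ^ 2 := by rw [hεdef]; field_simp
    have hδ : 0 < δ := by
      have h1 : 0 < 1 - (1 - c) ^ 2 := by nlinarith
      have h2 := mul_pos hX h1
      rw [hδdef]; nlinarith [h2]
    have hε1 : ε < 1 := by
      have h1 : ε ≤ c ^ 2 := by
        rw [hεdef, div_le_iff₀ hl0]; nlinarith [sq_nonneg c]
      nlinarith
    have hεm : topValue su2Rep L β * ε ≤ tQ - δ := by
      rw [hlmε, hXδ]; exact mul_le_mul_of_nonneg_left hcsq hX.le
    have door := le_walledTop_insert_of_rarity hβ κ Q p₀ hδ hε1 hεm (fun f hf hWf hpos hm => by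
      rw [hXδ] at hm
      have h := hRT f hf hWf hpos hm
      rw [hεdef]
      exact h)
    have key : Real.exp (-a') * tQ ≤ (Real.sqrt (tQ - δ) - Real.sqrt (topValue su2Rep L β * ε)) ^ 2 := by
      rw [hXδ, hlmε, sqrt_gap_sq_eq hX.le hc0.le (by linarith), hc2, mul_comm]
    exact le_exp_mul_of_exp_neg_mul_le (le_trans key door)
  · -- (S)
    have hX : 0 < sQ := walledSecond_pos L hβ κ Q
    have hXle : sQ ≤ topValue su2Rep L β :=
      (compressedSecond_le_sSup_rayleighSet hβ.le _).trans (sSup_rayleighSet_le_topValue hβ.le _)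
    set δ : ℝ := sQ - sQ * (1 - c) ^ 2 with hδdef
    set ε : ℝ := sQ * c ^ 2 / topValue su2Rep L β with hεdef
    have hXδ : sQ - δ = sQ * (1 - c) ^ 2 := by rw [hδdef]; ring
    have hlmε : topValue su2Rep L β * ε = sQ * c ^ 2 := by rw [hεdef]; field_simp
    have hδ : 0 < δ := by
      have h1 : 0 < 1 - (1 - c) ^ 2 := by nlinarith
      have h2 := mul_pos hX h1
      rw [hδdef]; nlinarith [h2]
    have hε1 : ε < 1 := by
      have h1 : ε ≤ c ^ 2 := by
        rw [hεdef, div_le_iff₀ hl0]; nlinarith [sq_nonneg c]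
      nlinarith
    have hεm : topValue su2Rep L β * ε ≤ sQ - δ := by
      rw [hlmε, hXδ]; exact mul_le_mul_of_nonneg_left hcsq hX.le
    have door := le_walledSecond_insert_of_planeRarity hβ κ Q p₀ hδ hε1 hεm
      (fun f₁ f₂ h₁ h₂ hW₁ hW₂ hn₁ hn₂ horth hfloor a b => by
        have hfloor' : ∀ a b : ℝ, sQ * (1 - c) ^ 2 * (a ^ 2 + b ^ 2) ≤
            qform su2Rep β (a • f₁ + b • f₂) (a • f₁ + b • f₂) := fun a b => by
          have h := hfloor a b
          rw [hXδ] at h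
          exact h
        have h := hRS f₁ f₂ h₁ h₂ hW₁ hW₂ hn₁ hn₂ horth hfloor' a b
        rw [hεdef]
        exact h)
    have key : Real.exp (-a') * sQ ≤ (Real.sqrt (sQ - δ) - Real.sqrt (topValue su2Rep L β * ε)) ^ 2 := by
      rw [hXδ, hlmε, sqrt_gap_sq_eq hX.le hc0.le (by linarith), hc2, mul_comm]
    exact le_exp_mul_of_exp_neg_mul_le (le_trans key door)

/-- ★ **The two cross-multiplied clauses of one wall step from rarity at that step**: under the hypotheses of
`oneWallLowerBounds_of_rarityAt`, `s(Q')^L t(Q)^L ≤ eᵃ s(Q)^L t(Q')^L` and `s(Q)^L t(Q')^L ≤ eᵃ s(Q')^L t(Q)^L`, `Q' = Q ∪ {p₀}`,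
`a = A/(β²N)` (monotone halves `walledTop_anti`/`walledSecond_anti`, endgame `cross_pow_le_of_step`). [cite: ReedSimonIV1978, Thm. XIII.1] -/
theorem crossComparisons_of_rarityAt {β : ℝ} (hβ : 0 < β) (κ : ℝ) {A : ℝ} (hA : 0 < A) (Q : Set (Plaquette 3 L)) (p₀ : Plaquette 3 L)
    {c : ℝ} (hc : c = (1 - Real.exp (-(A / β ^ 2 / (Fintype.card (Plaquette 3 L) : ℝ) / L / 2))) / 2)
    (hRT : ∀ f : GaugeConfig 3 L SU2 → ℝ, IsPhys f →
      (∀ U : GaugeConfig 3 L SU2,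
        (∃ p ∈ Q, β ^ (κ - 1) < 2 - (su2Rep (plaquetteHolonomy U p.1 p.2.1.1 p.2.1.2)).trace.re) → f U = 0) →
      0 < l2 f f →
      sSup (rayleighSet su2Rep L β fun ψ => ∀ U : GaugeConfig 3 L SU2,
        (∃ p ∈ Q, β ^ (κ - 1) < 2 - (su2Rep (plaquetteHolonomy U p.1 p.2.1.1 p.2.1.2)).trace.re) → ψ U = 0) * (1 - c) ^ 2 *
        l2 f f ≤ qform su2Rep β f f →
      l2 ({U : GaugeConfig 3 L SU2 | β ^ (κ - 1) < 2 - (su2Rep (plaquetteHolonomy U p₀.1 p₀.2.1.1 p₀.2.1.2)).trace.re}.indicator f)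
        ({U : GaugeConfig 3 L SU2 | β ^ (κ - 1) < 2 - (su2Rep (plaquetteHolonomy U p₀.1 p₀.2.1.1 p₀.2.1.2)).trace.re}.indicator f) ≤
        sSup (rayleighSet su2Rep L β fun ψ => ∀ U : GaugeConfig 3 L SU2,
          (∃ p ∈ Q, β ^ (κ - 1) < 2 - (su2Rep (plaquetteHolonomy U p.1 p.2.1.1 p.2.1.2)).trace.re) → ψ U = 0) * c ^ 2 /
          topValue su2Rep L β * l2 f f)
    (hRS : ∀ f₁ f₂ : GaugeConfig 3 L SU2 → ℝ, IsPhys f₁ → IsPhys f₂ →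
      (∀ U : GaugeConfig 3 L SU2,
        (∃ p ∈ Q, β ^ (κ - 1) < 2 - (su2Rep (plaquetteHolonomy U p.1 p.2.1.1 p.2.1.2)).trace.re) → f₁ U = 0) →
      (∀ U : GaugeConfig 3 L SU2,
        (∃ p ∈ Q, β ^ (κ - 1) < 2 - (su2Rep (plaquetteHolonomy U p.1 p.2.1.1 p.2.1.2)).trace.re) → f₂ U = 0) →
      l2 f₁ f₁ = 1 → l2 f₂ f₂ = 1 → l2 f₁ f₂ = 0 →
      (∀ a b : ℝ, sInf {x : ℝ | ∃ φ : GaugeConfig 3 L SU2 → ℝ, IsPhys φ ∧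
        x = sSup (rayleighSet su2Rep L β fun ψ => (∀ U : GaugeConfig 3 L SU2,
          (∃ p ∈ Q, β ^ (κ - 1) < 2 - (su2Rep (plaquetteHolonomy U p.1 p.2.1.1 p.2.1.2)).trace.re) → ψ U = 0) ∧ l2 ψ φ = 0)} *
          (1 - c) ^ 2 * (a ^ 2 + b ^ 2) ≤ qform su2Rep β (a • f₁ + b • f₂) (a • f₁ + b • f₂)) →
      ∀ a b : ℝ,
        l2 ({U : GaugeConfig 3 L SU2 | β ^ (κ - 1) < 2 - (su2Rep (plaquetteHolonomy U p₀.1 p₀.2.1.1 p₀.2.1.2)).trace.re}.indicator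
            (a • f₁ + b • f₂))
          ({U : GaugeConfig 3 L SU2 | β ^ (κ - 1) < 2 - (su2Rep (plaquetteHolonomy U p₀.1 p₀.2.1.1 p₀.2.1.2)).trace.re}.indicator
            (a • f₁ + b • f₂)) ≤
          sInf {x : ℝ | ∃ φ : GaugeConfig 3 L SU2 → ℝ, IsPhys φ ∧
            x = sSup (rayleighSet su2Rep L β fun ψ => (∀ U : GaugeConfig 3 L SU2,
              (∃ p ∈ Q, β ^ (κ - 1) < 2 - (su2Rep (plaquetteHolonomy U p.1 p.2.1.1 p.2.1.2)).trace.re) → ψ U = 0) ∧ l2 ψ φ = 0)} *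
            c ^ 2 / topValue su2Rep L β * (a ^ 2 + b ^ 2)) :
    sInf {x : ℝ | ∃ φ : GaugeConfig 3 L SU2 → ℝ, IsPhys φ ∧
        x = sSup (rayleighSet su2Rep L β fun ψ => (∀ U : GaugeConfig 3 L SU2,
          (∃ p ∈ insert p₀ Q, β ^ (κ - 1) < 2 - (su2Rep (plaquetteHolonomy U p.1 p.2.1.1 p.2.1.2)).trace.re) → ψ U = 0) ∧
          l2 ψ φ = 0)} ^ L *
      sSup (rayleighSet su2Rep L β fun ψ => ∀ U : GaugeConfig 3 L SU2,
        (∃ p ∈ Q, β ^ (κ - 1) < 2 - (su2Rep (plaquetteHolonomy U p.1 p.2.1.1 p.2.1.2)).trace.re) → ψ U = 0) ^ L ≤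
      Real.exp (A / β ^ 2 / (Fintype.card (Plaquette 3 L) : ℝ)) *
        (sInf {x : ℝ | ∃ φ : GaugeConfig 3 L SU2 → ℝ, IsPhys φ ∧
          x = sSup (rayleighSet su2Rep L β fun ψ => (∀ U : GaugeConfig 3 L SU2,
            (∃ p ∈ Q, β ^ (κ - 1) < 2 - (su2Rep (plaquetteHolonomy U p.1 p.2.1.1 p.2.1.2)).trace.re) → ψ U = 0) ∧ l2 ψ φ = 0)} ^ L *
        sSup (rayleighSet su2Rep L β fun ψ => ∀ U : GaugeConfig 3 L SU2,
          (∃ p ∈ insert p₀ Q, β ^ (κ - 1) < 2 - (su2Rep (plaquetteHolonomy U p.1 p.2.1.1 p.2.1.2)).trace.re) → ψ U = 0) ^ L) ∧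
    sInf {x : ℝ | ∃ φ : GaugeConfig 3 L SU2 → ℝ, IsPhys φ ∧
        x = sSup (rayleighSet su2Rep L β fun ψ => (∀ U : GaugeConfig 3 L SU2,
          (∃ p ∈ Q, β ^ (κ - 1) < 2 - (su2Rep (plaquetteHolonomy U p.1 p.2.1.1 p.2.1.2)).trace.re) → ψ U = 0) ∧ l2 ψ φ = 0)} ^ L *
      sSup (rayleighSet su2Rep L β fun ψ => ∀ U : GaugeConfig 3 L SU2,
        (∃ p ∈ insert p₀ Q, β ^ (κ - 1) < 2 - (su2Rep (plaquetteHolonomy U p.1 p.2.1.1 p.2.1.2)).trace.re) → ψ U = 0) ^ L ≤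
      Real.exp (A / β ^ 2 / (Fintype.card (Plaquette 3 L) : ℝ)) *
        (sInf {x : ℝ | ∃ φ : GaugeConfig 3 L SU2 → ℝ, IsPhys φ ∧
          x = sSup (rayleighSet su2Rep L β fun ψ => (∀ U : GaugeConfig 3 L SU2,
            (∃ p ∈ insert p₀ Q, β ^ (κ - 1) < 2 - (su2Rep (plaquetteHolonomy U p.1 p.2.1.1 p.2.1.2)).trace.re) → ψ U = 0) ∧
            l2 ψ φ = 0)} ^ L *
        sSup (rayleighSet su2Rep L β fun ψ => ∀ U : GaugeConfig 3 L SU2,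
          (∃ p ∈ Q, β ^ (κ - 1) < 2 - (su2Rep (plaquetteHolonomy U p.1 p.2.1.1 p.2.1.2)).trace.re) → ψ U = 0) ^ L) := by
  obtain ⟨ht, hs⟩ := oneWallLowerBounds_of_rarityAt hβ κ hA Q p₀ hc hRT hRS
  have hLne : L ≠ 0 := NeZero.ne L
  have hQ : Q ⊆ insert p₀ Q := Set.subset_insert p₀ Q
  have ht' := walledTop_anti hβ.le κ hQ
  have hs' := walledSecond_anti hβ.le κ hQ
  have ht0 := sSup_rayleighSet_nonneg hβ.le (L := L) (fun ψ => ∀ U : GaugeConfig 3 L SU2,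
    (∃ p ∈ Q, β ^ (κ - 1) < 2 - (su2Rep (plaquetteHolonomy U p.1 p.2.1.1 p.2.1.2)).trace.re) → ψ U = 0)
  have ht'0 := sSup_rayleighSet_nonneg hβ.le (L := L) (fun ψ => ∀ U : GaugeConfig 3 L SU2,
    (∃ p ∈ insert p₀ Q, β ^ (κ - 1) < 2 - (su2Rep (plaquetteHolonomy U p.1 p.2.1.1 p.2.1.2)).trace.re) → ψ U = 0)
  have hs0 := compressedSecond_nonneg hβ.le (L := L) (fun ψ => ∀ U : GaugeConfig 3 L SU2,
    (∃ p ∈ Q, β ^ (κ - 1) < 2 - (su2Rep (plaquetteHolonomy U p.1 p.2.1.1 p.2.1.2)).trace.re) → ψ U = 0)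
  have hs'0 := compressedSecond_nonneg hβ.le (L := L) (fun ψ => ∀ U : GaugeConfig 3 L SU2,
    (∃ p ∈ insert p₀ Q, β ^ (κ - 1) < 2 - (su2Rep (plaquetteHolonomy U p.1 p.2.1.1 p.2.1.2)).trace.re) → ψ U = 0)
  refine ⟨cross_pow_le_of_step hLne hs'0 hs' ht0 ht, ?_⟩
  have h2 := cross_pow_le_of_step hLne ht'0 ht' hs0 hs
  calc _ = _ := mul_comm _ _
    _ ≤ _ := h2
    _ = _ := by rw [mul_comm (sSup _ ^ L) (sInf _ ^ L)]

end Summit.QuantumFields.YangMills.Theorems.FemtoTransferGap.SFCompression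

namespace Summit.QuantumFields.YangMills.Theorems.FemtoCutoffLadder

open Summit.QuantumFields.YangMills.Theorems.FemtoTransferGap
open Summit.QuantumFields.YangMills.Theses.FemtoCutoffLadder

/-! ## §2 ★ The extreme wall sets BY NAME -/

/-- ★ **`SingleWallStep` (stmt-QuantumFields-26631, the line's FIRST ATTACK) BY NAME from one-plaquette rarity at the EMPTY wall set**: deep in
the femto window, near-optimal UNWALLED physical trial functions (Rayleigh `≥ (1−c)²λ₀`-type floor) and near-optimal orthonormal trial planes
(span floor `(1−c)²λ₁`-type) put at most the fraction `c²·value/λ₀` of their mass on «`p₀` is κ-bad», `c = (1 − e^{−A/(2β²NL)})/2`, for every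
plaquette `p₀`. [cite: ReedSimonIV1978, Thm. XIII.1] -/
theorem singleWallStep_of_onePlaquetteRarityAtEmpty
    (hR : ∀ κ : ℝ, 0 < κ → κ < 1 → ∃ (A lam0 : ℝ) (L0 : ℕ), 0 < A ∧ 0 < lam0 ∧ ∀ lam : ℝ, 0 < lam → lam ≤ lam0 →
      ∀ (L : ℕ) [NeZero L], L0 ≤ L → ∀ β : ℝ, InFemtoWindow lam β L →
      let W : Set (Plaquette 3 L) → (GaugeConfig 3 L SU2 → ℝ) → Prop := fun Q ψ => ∀ U,
        (∃ p ∈ Q, β ^ (κ - 1) < 2 - (su2Rep (plaquetteHolonomy U p.1 p.2.1.1 p.2.1.2)).trace.re) → ψ U = 0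
      let t : Set (Plaquette 3 L) → ℝ := fun Q => sSup (rayleighSet su2Rep L β (W Q))
      let s : Set (Plaquette 3 L) → ℝ := fun Q => sInf {x : ℝ | ∃ φ : GaugeConfig 3 L SU2 → ℝ, IsPhys φ ∧
        x = sSup (rayleighSet su2Rep L β fun ψ => W Q ψ ∧ l2 ψ φ = 0)}
      let c : ℝ := (1 - Real.exp (-(A / β ^ 2 / (Fintype.card (Plaquette 3 L) : ℝ) / L / 2))) / 2
      let B : Plaquette 3 L → Set (GaugeConfig 3 L SU2) := fun p₀ =>
        {U | β ^ (κ - 1) < 2 - (su2Rep (plaquetteHolonomy U p₀.1 p₀.2.1.1 p₀.2.1.2)).trace.re}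
      ∀ p₀ : Plaquette 3 L,
        (∀ f : GaugeConfig 3 L SU2 → ℝ, IsPhys f → W (∅ : Set (Plaquette 3 L)) f → 0 < l2 f f →
            t (∅ : Set (Plaquette 3 L)) * (1 - c) ^ 2 * l2 f f ≤ qform su2Rep β f f →
            l2 ((B p₀).indicator f) ((B p₀).indicator f) ≤ t (∅ : Set (Plaquette 3 L)) * c ^ 2 / topValue su2Rep L β * l2 f f) ∧
        (∀ f₁ f₂ : GaugeConfig 3 L SU2 → ℝ, IsPhys f₁ → IsPhys f₂ → W (∅ : Set (Plaquette 3 L)) f₁ → W (∅ : Set (Plaquette 3 L)) f₂ →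
            l2 f₁ f₁ = 1 → l2 f₂ f₂ = 1 → l2 f₁ f₂ = 0 →
            (∀ a b : ℝ, s (∅ : Set (Plaquette 3 L)) * (1 - c) ^ 2 * (a ^ 2 + b ^ 2) ≤ qform su2Rep β (a • f₁ + b • f₂) (a • f₁ + b • f₂)) →
            ∀ a b : ℝ, l2 ((B p₀).indicator (a • f₁ + b • f₂)) ((B p₀).indicator (a • f₁ + b • f₂)) ≤
              s (∅ : Set (Plaquette 3 L)) * c ^ 2 / topValue su2Rep L β * (a ^ 2 + b ^ 2))) :
    SingleWallStep := by
  refine singleWallStep_of_comparisons fun κ hκ hκ1 => ?_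
  obtain ⟨A, lam0, L0, hA, hlam0, H⟩ := hR κ hκ hκ1
  refine ⟨A, lam0, L0, hA.le, hlam0, fun lam hlam hle L _ hL0 β hW => ?_⟩
  have hβ : 0 < β := by linarith [hW.1]
  intro W t s p₀
  obtain ⟨HT, HS⟩ := H lam hlam hle L hL0 β hW p₀
  exact SFCompression.crossComparisons_of_rarityAt hβ κ hA (∅ : Set (Plaquette 3 L)) p₀ rfl HT HS

/-- ★ **`LastWallStep` (stmt-QuantumFields-26638) BY NAME from one-plaquette rarity at the co-atom wall set `univ ∖ {p₀}`**: near-optimal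
trial functions / planes walled at EVERY OTHER plaquette put at most the fraction `c²·value/λ₀` on «`p₀` is κ-bad». [cite: ReedSimonIV1978, Thm. XIII.1] -/
theorem lastWallStep_of_onePlaquetteRarityAtCoatom
    (hR : ∀ κ : ℝ, 0 < κ → κ < 1 → ∃ (A lam0 : ℝ) (L0 : ℕ), 0 < A ∧ 0 < lam0 ∧ ∀ lam : ℝ, 0 < lam → lam ≤ lam0 →
      ∀ (L : ℕ) [NeZero L], L0 ≤ L → ∀ β : ℝ, InFemtoWindow lam β L →
      let W : Set (Plaquette 3 L) → (GaugeConfig 3 L SU2 → ℝ) → Prop := fun Q ψ => ∀ U,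
        (∃ p ∈ Q, β ^ (κ - 1) < 2 - (su2Rep (plaquetteHolonomy U p.1 p.2.1.1 p.2.1.2)).trace.re) → ψ U = 0
      let t : Set (Plaquette 3 L) → ℝ := fun Q => sSup (rayleighSet su2Rep L β (W Q))
      let s : Set (Plaquette 3 L) → ℝ := fun Q => sInf {x : ℝ | ∃ φ : GaugeConfig 3 L SU2 → ℝ, IsPhys φ ∧
        x = sSup (rayleighSet su2Rep L β fun ψ => W Q ψ ∧ l2 ψ φ = 0)}
      let c : ℝ := (1 - Real.exp (-(A / β ^ 2 / (Fintype.card (Plaquette 3 L) : ℝ) / L / 2))) / 2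
      let B : Plaquette 3 L → Set (GaugeConfig 3 L SU2) := fun p₀ =>
        {U | β ^ (κ - 1) < 2 - (su2Rep (plaquetteHolonomy U p₀.1 p₀.2.1.1 p₀.2.1.2)).trace.re}
      ∀ p₀ : Plaquette 3 L,
        (∀ f : GaugeConfig 3 L SU2 → ℝ, IsPhys f → W ((Set.univ : Set (Plaquette 3 L)) \ {p₀}) f → 0 < l2 f f →
            t ((Set.univ : Set (Plaquette 3 L)) \ {p₀}) * (1 - c) ^ 2 * l2 f f ≤ qform su2Rep β f f →
            l2 ((B p₀).indicator f) ((B p₀).indicator f) ≤ t ((Set.univ : Set (Plaquette 3 L)) \ {p₀}) * c ^ 2 / topValue su2Rep L β * l2 f f) ∧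
        (∀ f₁ f₂ : GaugeConfig 3 L SU2 → ℝ, IsPhys f₁ → IsPhys f₂ → W ((Set.univ : Set (Plaquette 3 L)) \ {p₀}) f₁ → W ((Set.univ : Set (Plaquette 3 L)) \ {p₀}) f₂ →
            l2 f₁ f₁ = 1 → l2 f₂ f₂ = 1 → l2 f₁ f₂ = 0 →
            (∀ a b : ℝ, s ((Set.univ : Set (Plaquette 3 L)) \ {p₀}) * (1 - c) ^ 2 * (a ^ 2 + b ^ 2) ≤ qform su2Rep β (a • f₁ + b • f₂) (a • f₁ + b • f₂)) →
            ∀ a b : ℝ, l2 ((B p₀).indicator (a • f₁ + b • f₂)) ((B p₀).indicator (a • f₁ + b • f₂)) ≤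
              s ((Set.univ : Set (Plaquette 3 L)) \ {p₀}) * c ^ 2 / topValue su2Rep L β * (a ^ 2 + b ^ 2))) :
    LastWallStep := by
  refine lastWallStep_of_comparisons fun κ hκ hκ1 => ?_
  obtain ⟨A, lam0, L0, hA, hlam0, H⟩ := hR κ hκ hκ1
  refine ⟨A, lam0, L0, hA.le, hlam0, fun lam hlam hle L _ hL0 β hW => ?_⟩
  have hβ : 0 < β := by linarith [hW.1]
  intro W t s p₀
  obtain ⟨HT, HS⟩ := H lam hlam hle L hL0 β hW p₀
  exact SFCompression.crossComparisons_of_rarityAt hβ κ hA ((Set.univ : Set (Plaquette 3 L)) \ {p₀}) p₀ rfl HT HS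

end Summit.QuantumFields.YangMills.Theorems.FemtoCutoffLadder

end
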